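import Summits.SmoothPoincare4.SmoothPoincare4.Theorems.SullivanDualTargetOfSympcap
import Literature.Geometry.Symplectic.GromovR4StdModel

/-!
# Helper `helper_formGlue` of stub `stub_ballExtension` — gluing two pulled-back standard forms

Line `kaehler-jacket`, crux `SullivanDual.Target` (stmt-SmoothPoincare4-7823).

**Setting.** On the punctured homotopy `4`-sphere `punctured p` (an open submanifold of
`Σ = S.carrier`, charted on `ℝ⁴`) we are given an open set `U` containing a closed set `K`,
a map `Θ : punctured p → ℝ⁴` of class `C^∞` with injective differential at every point of `U`
(the cap immersion), a map `F : punctured p → ℝ⁴` of class `C^∞` with injective differential at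
every point off `K` (the jacket), and the pointwise agreement `Θ*ω₀ = F*ω₀` on `U ∖ K`, where
`ω₀ = stdSymplecticForm` is the standard symplectic form of `ℝ⁴`.

**Claim (`helper_formGlue`).** There is a `2`-form `sf` on `punctured p` which is smooth,
closed, pointwise nondegenerate, and equals `F*ω₀` off `K`.

**Construction and proof.** `sf x := (Θ*ω₀) x` for `x ∈ U` and `sf x := (F*ω₀) x` otherwise
(`stdSymplecticMForm.pullback`, the tree's pull-back of forms). By the agreement hypothesis,
`sf = F*ω₀` at every point off `K` (clause 4). Hence `sf` is, near every point, the pull-back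
`G*ω₀` of the constant form `ω₀` along a map `G` which is `C^∞` near that point (`G = Θ` on the
open set `U`, `G = F` on the open set `Kᶜ ⊇ Uᶜ`): such a form is smooth (pull-back of a smooth
form, Warner 2.22, `MForm.SmoothAt.pullback`, plus locality of smoothness) and closed
(`d(G*ω₀) = G*(dω₀) = 0`, Warner 2.23, `mextDeriv_pullback_apply`, plus locality of `d`).
Nondegeneracy at `x`: `sf x = ω₀(L ·, L ·)` with `L = dG_x : ℝ⁴ → ℝ⁴` injective, hence
bijective; for `v ≠ 0`, `L v ≠ 0` pairs nontrivially with some `w' = L w` under `ω₀`.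

References: F. W. Warner, *Foundations of Differentiable Manifolds and Lie Groups*, GTM 94
(1983), 2.22–2.23 [WarnerGTM94]; D. McDuff, D. Salamon, *Introduction to Symplectic Topology*,
3rd ed. (2017), §1.1 (1.1.21) [McDuffSalamon2017].
-/

noncomputable section

-- the prescribed namespace `Summit.<P>.<Sub>.…` duplicates `SmoothPoincare4` (P = Sub)
set_option linter.dupNamespace false

open scoped Manifold ContDiff Topology
open Set Function
open Literature.Geometry.Kaehler (MForm IsSmoothForm IsClosedForm mextDeriv)
open Literature.Geometry.Symplectic (punctured InPuncturedChartBall stdSymplecticForm inversion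
  invertedStdForm IsSymplecticStandardNearPoint AgreesWithInvertedChartNear)
open Literature.Topology.FourManifolds (HomotopySphere)

namespace Summit.SmoothPoincare4.SmoothPoincare4.Theorems.Target.KaehlerJacket

/-- Model space `ℝ⁴`. -/
local notation "E4" => EuclideanSpace ℝ (Fin 4)

open Filter
open Literature.Geometry.Symplectic (stdSymplecticMForm stdSymplecticMForm_apply
  stdSymplecticMForm_pullback_apply stdSymplecticMForm_nondegenerate
  isSmoothForm_stdSymplecticMForm isClosedForm_stdSymplecticMForm)
open Literature.Geometry.Kaehler (isSmoothForm_iff_smoothAt mextDeriv_congr_of_eventuallyEq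
  mextDeriv_pullback_apply)

/-! ### Forms that are locally pull-backs of `ω₀` -/

section LocallyPullback

variable {EM : Type*} [NormedAddCommGroup EM] [NormedSpace ℝ EM] {HM : Type*}
  [TopologicalSpace HM] {I : ModelWithCorners ℝ EM HM}
  {N : Type*} [TopologicalSpace N] [ChartedSpace HM N] [IsManifold I ∞ N]

/-- **A form which is locally `G*ω₀` for `C^∞` maps `G` is smooth.** If near every point `x`
the `2`-form `sf` coincides with the pull-back of the standard symplectic form `ω₀` of `ℝ⁴`
along some map `G` of class `C^∞` near `x`, then `sf` is smooth: `G*ω₀` is smooth at `x`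
(Warner (1983), 2.22, `MForm.SmoothAt.pullback`, `ω₀` being a smooth form), and smoothness
at a point only depends on the germ (`MForm.SmoothAt.congr_of_eventuallyEq`).
[cite: WarnerGTM94, 2.22] -/
theorem isSmoothForm_of_locally_pullback_std {sf : MForm I N ℝ 2}
    (h : ∀ x : N, ∃ G : N → E4, (∀ᶠ z in 𝓝 x, ContMDiffAt I (𝓡 4) ∞ G z) ∧
      ∀ᶠ z in 𝓝 x, sf z = stdSymplecticMForm.pullback I G z) :
    IsSmoothForm sf := by
  rw [isSmoothForm_iff_smoothAt]
  intro x
  obtain ⟨G, hG, hsf⟩ := h x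
  have hω : (stdSymplecticMForm).SmoothAt (G x) :=
    (isSmoothForm_iff_smoothAt _).1 isSmoothForm_stdSymplecticMForm (G x)
  have hpull : (stdSymplecticMForm.pullback I G).SmoothAt x :=
    Literature.Geometry.Kaehler.MForm.SmoothAt.pullback hG hω
  exact hpull.congr_of_eventuallyEq (hsf.mono fun z hz => hz.symm)

/-- **A form which is locally `G*ω₀` for `C^∞` maps `G` is closed.** With the hypothesis of
`isSmoothForm_of_locally_pullback_std`: `d sf = d(G*ω₀)` at `x` (locality of `d`,
`mextDeriv_congr_of_eventuallyEq`), `d(G*ω₀) x = (G*dω₀) x` (naturality of `d`, Warner (1983),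
Prop. 2.23, `mextDeriv_pullback_apply`) and `dω₀ = 0` (`isClosedForm_stdSymplecticMForm`).
[cite: WarnerGTM94, Prop. 2.23] -/
theorem isClosedForm_of_locally_pullback_std {sf : MForm I N ℝ 2}
    (h : ∀ x : N, ∃ G : N → E4, (∀ᶠ z in 𝓝 x, ContMDiffAt I (𝓡 4) ∞ G z) ∧
      ∀ᶠ z in 𝓝 x, sf z = stdSymplecticMForm.pullback I G z) :
    IsClosedForm sf := by
  show mextDeriv sf = 0
  funext x
  obtain ⟨G, hG, hsf⟩ := h x
  have hω : (stdSymplecticMForm).SmoothAt (G x) :=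
    (isSmoothForm_iff_smoothAt _).1 isSmoothForm_stdSymplecticMForm (G x)
  rw [mextDeriv_congr_of_eventuallyEq hsf, mextDeriv_pullback_apply hG hω]
  have h0 : mextDeriv stdSymplecticMForm = 0 := isClosedForm_stdSymplecticMForm
  rw [h0, Literature.Geometry.Kaehler.MForm.pullback_zero]

end LocallyPullback

/-! ### Nondegeneracy of `G*ω₀` at a point where `dG` is injective -/

section Nondegenerate

variable {N : Type*} [TopologicalSpace N] [ChartedSpace E4 N]

/-- **`G*ω₀` is nondegenerate at a point of a `4`-manifold where `dG_x` is injective.** The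
differential `L = dG_x : ℝ⁴ → ℝ⁴` is an injective endomorphism of a finite-dimensional space,
hence surjective; for `v ≠ 0` the vector `L v ≠ 0` pairs nontrivially under `ω₀` with some `w'`
(`ω₀(u, J₀ u) = ‖u‖²`, `stdSymplecticMForm_nondegenerate`), and `w' = L w` for some `w`, so
`(G*ω₀)_x(v, w) = ω₀(L v, L w) ≠ 0`. [cite: McDuffSalamon2017, §1.1 (1.1.21)] -/
theorem stdSymplecticMForm_pullback_nondegenerate_of_injective (G : N → E4) (x : N)
    (hG : Injective (mfderiv (𝓡 4) (𝓡 4) G x)) (v : TangentSpace (𝓡 4) x) (hv : v ≠ 0) :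
    ∃ w : TangentSpace (𝓡 4) x, stdSymplecticMForm.pullback (𝓡 4) G x ![v, w] ≠ 0 := by
  obtain ⟨L, hL⟩ : ∃ L : E4 →L[ℝ] E4, mfderiv (𝓡 4) (𝓡 4) G x = L := ⟨_, rfl⟩
  have hinj : Injective L := hL ▸ hG
  have hsurj : Surjective L :=
    LinearMap.surjective_of_injective (f := (L : E4 →ₗ[ℝ] E4)) hinj
  have hLv : L v ≠ 0 := fun h0 => hv (hinj (h0.trans (map_zero L).symm))
  obtain ⟨w', hw'⟩ := stdSymplecticMForm_nondegenerate (G x) (L v) hLv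
  obtain ⟨w, rfl⟩ := hsurj w'
  refine ⟨w, ?_⟩
  rw [stdSymplecticMForm_pullback_apply, hL]
  rwa [stdSymplecticMForm_apply] at hw'

end Nondegenerate

/-! ### The gluing -/

/-- **Helper E (gluing two pulled-back standard forms along an open/closed pair).** On the
punctured homotopy sphere `punctured p`, let `U ⊇ K` with `U` open and `K` closed, `Θ` a `C^∞`
immersion at the points of `U`, `F` a `C^∞` immersion at the points off `K`, with
`Θ*ω₀ = F*ω₀` pointwise on `U ∖ K`. Then the form `sf = Θ*ω₀` on `U`, `= F*ω₀` off `U` is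
smooth, closed, pointwise nondegenerate, and equals `F*ω₀` off `K`: by the agreement it is
near every point the pull-back of `ω₀` along a local `C^∞` immersion (`Θ` on the open `U`,
`F` on the open `Kᶜ`), to which `isSmoothForm_of_locally_pullback_std`,
`isClosedForm_of_locally_pullback_std` and
`stdSymplecticMForm_pullback_nondegenerate_of_injective` apply. [folklore] -/
theorem helper_formGlue :
    ∀ (S : HomotopySphere 4) (p : S.carrier) (U K : Set (punctured p)) (Θ F : punctured p → E4),
      IsOpen U → IsClosed K → K ⊆ U →
      (∀ x ∈ U, ContMDiffAt (𝓡 4) 𝓘(ℝ, E4) ∞ Θ x ∧ Injective (mfderiv (𝓡 4) 𝓘(ℝ, E4) Θ x)) →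
      (∀ x, x ∉ K → ContMDiffAt (𝓡 4) 𝓘(ℝ, E4) ∞ F x ∧ Injective (mfderiv (𝓡 4) 𝓘(ℝ, E4) F x)) →
      (∀ x ∈ U, x ∉ K → ∀ v w : TangentSpace (𝓡 4) x,
        stdSymplecticForm (mfderiv (𝓡 4) 𝓘(ℝ, E4) Θ x v) (mfderiv (𝓡 4) 𝓘(ℝ, E4) Θ x w) =
          stdSymplecticForm (mfderiv (𝓡 4) 𝓘(ℝ, E4) F x v) (mfderiv (𝓡 4) 𝓘(ℝ, E4) F x w)) →
      ∃ sf : MForm (𝓡 4) (punctured p) ℝ 2,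
        IsSmoothForm sf ∧ IsClosedForm sf ∧
        (∀ (x : punctured p) (v : TangentSpace (𝓡 4) x), v ≠ 0 → ∃ w, sf x ![v, w] ≠ 0) ∧
        (∀ x : punctured p, x ∉ K → ∀ v w : TangentSpace (𝓡 4) x, sf x ![v, w] =
          stdSymplecticForm (mfderiv (𝓡 4) 𝓘(ℝ, E4) F x v) (mfderiv (𝓡 4) 𝓘(ℝ, E4) F x w)) := by
  intro S p U K Θ F hU hK hKU hΘ hF hagree
  classical
  -- the two pulled-back forms and the glued form
  set ωΘ : MForm (𝓡 4) (punctured p) ℝ 2 := stdSymplecticMForm.pullback (𝓡 4) Θ with hωΘ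
  set ωF : MForm (𝓡 4) (punctured p) ℝ 2 := stdSymplecticMForm.pullback (𝓡 4) F with hωF
  let sf : MForm (𝓡 4) (punctured p) ℝ 2 := fun x => if x ∈ U then ωΘ x else ωF x
  have hsfU : ∀ x ∈ U, sf x = ωΘ x := fun x hx => if_pos hx
  have hsfU' : ∀ x, x ∉ U → sf x = ωF x := fun x hx => if_neg hx
  -- two vectors form the tuple `![m 0, m 1]`
  have htuple : ∀ (x : punctured p) (m : Fin 2 → TangentSpace (𝓡 4) x), m = ![m 0, m 1] := by
    intro x m
    funext i
    fin_cases i <;> rfl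
  -- (0) off `K` the glued form is `F*ω₀`
  have hoff : ∀ x, x ∉ K → sf x = ωF x := by
    intro x hxK
    by_cases hxU : x ∈ U
    · rw [hsfU x hxU]
      ext m
      rw [htuple x m, hωΘ, hωF, stdSymplecticMForm_pullback_apply,
        stdSymplecticMForm_pullback_apply]
      exact hagree x hxU hxK (m 0) (m 1)
    · exact hsfU' x hxU
  -- (1) `sf` is locally the pull-back of `ω₀` along a local `C^∞` immersion
  have hloc : ∀ x : punctured p, ∃ G : punctured p → E4,
      (∀ᶠ z in 𝓝 x, ContMDiffAt (𝓡 4) (𝓡 4) ∞ G z) ∧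
      Injective (mfderiv (𝓡 4) (𝓡 4) G x) ∧
      (∀ᶠ z in 𝓝 x, sf z = stdSymplecticMForm.pullback (𝓡 4) G z) := by
    intro x
    by_cases hxU : x ∈ U
    · have hUx : ∀ᶠ z in 𝓝 x, z ∈ U := hU.mem_nhds hxU
      exact ⟨Θ, hUx.mono fun z hz => (hΘ z hz).1, (hΘ x hxU).2,
        hUx.mono fun z hz => hsfU z hz⟩
    · have hxK : x ∉ K := fun h => hxU (hKU h)
      have hKx : ∀ᶠ z in 𝓝 x, z ∉ K := hK.isOpen_compl.mem_nhds hxK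
      exact ⟨F, hKx.mono fun z hz => (hF z hz).1, (hF x hxK).2,
        hKx.mono fun z hz => hoff z hz⟩
  refine ⟨sf, ?_, ?_, ?_, ?_⟩
  · -- smooth
    exact isSmoothForm_of_locally_pullback_std fun x =>
      let ⟨G, hG, _, hsf⟩ := hloc x; ⟨G, hG, hsf⟩
  · -- closed
    exact isClosedForm_of_locally_pullback_std fun x =>
      let ⟨G, hG, _, hsf⟩ := hloc x; ⟨G, hG, hsf⟩
  · -- nondegenerate
    intro x v hv
    obtain ⟨G, -, hGinj, hsf⟩ := hloc x
    obtain ⟨w, hw⟩ := stdSymplecticMForm_pullback_nondegenerate_of_injective G x hGinj v hv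
    refine ⟨w, ?_⟩
    rwa [hsf.self_of_nhds]
  · -- agreement with `F*ω₀` off `K`
    intro x hxK v w
    rw [hoff x hxK, hωF, stdSymplecticMForm_pullback_apply]

end Summit.SmoothPoincare4.SmoothPoincare4.Theorems.Target.KaehlerJacket

end
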